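import Summits.QuantumFields.YangMills.Theorems.LuscherReductionTwistedTraceScalingGaugeAverageBased
import Summits.QuantumFields.YangMills.Theorems.LuscherReductionTwistedTraceScalingGaugeSliceKernel
import HarnessLib

/-!
# Gauge average = colour average ∘ based average: the `g = c·h` split of the gauge-averaged kernel (first step of the (B-T) pen)
# (lane A of S-BASE, crux `TwistedTraceScaling` stmt-QuantumFields-20203, C4 INNER; design note `pub/ym-fleet/ym-luscher-20007-p1/COARSE-DESIGN.md` §24.10)

Every gauge transformation is uniquely `g = c·h` with `c ∈ SU(2)` constant (its value at the origin) and `h` based (`h(0) = 1`), and Haar factors accordingly.  `…GaugeAverageBased` has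
the constant-INVARIANT case (`integral_gaugeMeasure_eq_based`); here the general split and its application to the averaged kernel:
* ★ `integral_gaugeMeasure_eq_colour_based` — `∫ F(g) dg = ∫_c ∫_h F(c·basedExt h) dh dc` for bounded measurable `F`;
* ★★ `avgKernel_eq_colour_based` — `K̃_β(U,V) = ∫_c ∫_h K_β(U, c·(V^{basedExt h})·c⁻¹) dh dc`: the colour rotation `c` acts on the slow variable of `V` by `Ad` (cdisprove R32), the
  based `h` is the Gaussian gauge fibre of the Laplace step.
HONEST FRAMING: bookkeeping toward (B-T) for a stub of a child of the CONDITIONAL reduction route R2b1; (B-T) OPEN; C4 OPEN; not a gap, not Clay.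
-/

set_option autoImplicit false

noncomputable section

open MeasureTheory Filter Topology Real
open scoped BigOperators
open Literature.MathematicalPhysics.QuantumFieldTheory
open Literature.MathematicalPhysics.QuantumLattice

namespace Summit.QuantumFields.YangMills.Theorems.FemtoTransferGap.TwoLattice.ConstTube

open Summit.QuantumFields.YangMills.Theorems.FemtoTransferGap
open Summit.QuantumFields.YangMills.Theorems.FemtoTransferGap.TwoLattice.Avg

variable (L : ℕ) [NeZero L]

omit [NeZero L] in
/-- Re-assembling the split of a gauge transformation at the origin: `e.symm (a, b) = a₀ · basedExt (a₀⁻¹ b)`. [folklore] -/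
theorem split_symm_eq (a : {x : Site 3 L // x = 0} → SU2) (b : NzSite L → SU2) :
    ((MeasurableEquiv.piEquivPiSubtypeProd (fun _ : Site 3 L => SU2) (fun x => x = 0)).symm (a, b) : Site 3 L → SU2) =
      fun x => a ⟨0, rfl⟩ * basedExt L (fun y => (a ⟨0, rfl⟩)⁻¹ * b y) x := by
  have h := inv_mul_split_symm L a b
  funext x
  have hx := congrFun h x
  rw [← hx, ← mul_assoc, mul_inv_cancel, one_mul]

/-- ★ **`∫ F(g) dg = ∫_c ∫_h F(c · basedExt h) dh dc`** for bounded measurable `F` on the gauge group. [folklore] -/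
theorem integral_gaugeMeasure_eq_colour_based {F : (Site 3 L → SU2) → ℝ} (hF : Measurable F) {C : ℝ} (hC : ∀ g, |F g| ≤ C) :
    ∫ g, F g ∂gaugeMeasure L = ∫ c, ∫ h, F (fun x => c * basedExt L h x) ∂basedMeasure L ∂haarProbability SU2 := by
  set e := MeasurableEquiv.piEquivPiSubtypeProd (fun _ : Site 3 L => SU2) (fun x => x = 0) with he
  have hmp := measurePreserving_piEquivPiSubtypeProd (fun _ : Site 3 L => haarProbability SU2) (fun x => x = 0)
  have h1 := hmp.integral_comp' (fun p => F (e.symm p))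
  simp only [← he, MeasurableEquiv.symm_apply_apply] at h1
  rw [show gaugeMeasure L = Measure.pi (fun _ : Site 3 L => haarProbability SU2) from rfl, h1]
  rw [integral_prod (fun p => F (e.symm p)) (Integrable.mono' (integrable_const C) (hF.comp e.symm.measurable).aestronglyMeasurable
    (ae_of_all _ fun p => by rw [Real.norm_eq_abs]; exact hC _))]
  -- inner integral: left-translate the based variable
  have hinner : ∀ a : {x : Site 3 L // x = 0} → SU2,
      ∫ b, F (e.symm (a, b)) ∂basedMeasure L = ∫ h, F (fun x => a ⟨0, rfl⟩ * basedExt L h x) ∂basedMeasure L := fun a => by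
    have hrew : ∀ b : NzSite L → SU2, F (e.symm (a, b)) = (fun b' : NzSite L → SU2 => F (fun x => a ⟨0, rfl⟩ * basedExt L b' x)) ((fun _ => (a ⟨0, rfl⟩)⁻¹) * b) :=
      fun b => by rw [he, split_symm_eq]; rfl
    simp_rw [hrew]
    exact integral_mul_left_eq_self (μ := basedMeasure L) (E := ℝ) (fun b' : NzSite L → SU2 => F (fun x => a ⟨0, rfl⟩ * basedExt L b' x)) (fun _ => (a ⟨0, rfl⟩)⁻¹)
  simp_rw [hinner]
  -- outer integral: the origin factor is one copy of `SU(2)`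
  haveI : Unique {x : Site 3 L // x = 0} := ⟨⟨⟨0, rfl⟩⟩, fun y => Subtype.ext y.2⟩
  have hmu := measurePreserving_funUnique (haarProbability SU2) {x : Site 3 L // x = 0}
  have h2 := hmu.integral_comp' (fun c : SU2 => ∫ h, F (fun x => c * basedExt L h x) ∂basedMeasure L)
  have hF2 : (Unique.fintype : Fintype {x : Site 3 L // x = 0}) = Subtype.fintype fun x : Site 3 L => x = 0 := Subsingleton.elim _ _
  rw [hF2] at h2
  refine Eq.trans (integral_congr_ae (ae_of_all _ fun a => ?_)) h2
  have ha : (MeasurableEquiv.funUnique {x : Site 3 L // x = 0} SU2) a = a ⟨0, rfl⟩ := by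
    simp only [MeasurableEquiv.funUnique_apply]; exact congrArg a (Subsingleton.elim _ _)
  simp only [ha]

variable {L}

/-- ★★ **THE `g = c·h` SPLIT OF THE AVERAGED KERNEL**: `K̃_β(U,V) = ∫_c ∫_h K_β(U, c·(V^{basedExt h})·c⁻¹) dh dc`. [cite: SeilerLNP1982, §3] -/
theorem avgKernel_eq_colour_based (β : ℝ) (U V : GaugeConfig 3 L SU2) :
    avgKernel β U V = ∫ c, ∫ h, transferKernel su2Rep β U (gaugeTransform (fun _ : Site 3 L => c) (gaugeTransform (basedExt L h) V)) ∂basedMeasure L ∂haarProbability SU2 := by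
  haveI : SecondCountableTopology SU2 := secondCountableTopology_su2
  obtain ⟨M, hM⟩ := exists_transferKernel_le su2Rep continuous_su2Rep β (L := L)
  unfold avgKernel
  rw [integral_gaugeMeasure_eq_colour_based L (measurable_transferKernel_gaugeTransform_right β U V) (C := M)
    (fun g => by rw [abs_of_pos (transferKernel_pos su2Rep β _ _)]; exact hM _ _)]
  refine integral_congr_ae (ae_of_all _ fun c => integral_congr_ae (ae_of_all _ fun h => ?_))
  dsimp only
  rw [gaugeTransform_gaugeTransform]
  rfl

end Summit.QuantumFields.YangMills.Theorems.FemtoTransferGap.TwoLattice.ConstTube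

end
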